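import Literature.NumberTheory.Transcendental.CijsouwWaldschmidt1977Setup
import Mathlib.Analysis.Complex.CauchyIntegral
import Mathlib.Analysis.SpecialFunctions.Exponential
import Mathlib.Algebra.Order.Antidiag.Prod
import HarnessLib

/-!
# Cell abc-stewartyu, rung A1.L (crux r2 `ArchCoreRat`), parcel WP-L.A P-A4: the TAYLOR-NORMALISED jets majorant for an archimedean
# family of entire functions closed under `d/dz` — setup-free (for the k-step seat's `ArchG3KStepCore`)

`Summits/ABC/StewartYu/ArchG3JetsCore.lean` — cell `abc-stewartyu` (seat p5-g7; tranche plan §4′ P-A4; the budget FINDING of HOME/STATUS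
2026-08-27T14:34Z).  Definitions (`jetA`, `jetB`, `jetMaj` — explicit real majorants) and theorems; no named fact; NO dependence on the
set-up (only the multi-index type `CW77.Setup.Tau n = ℕ × (Fin n → ℕ)` and `bumpτ`).

THE POINT.  For a family `F : Tau n → ℂ → ℂ` of entire functions with `deriv (F τ) = Σ_{i : Fin (n+1)} c τ i · F (τ + eᵢ)`, the crude
control of derivatives by values loses `(Σᵢ ‖c τ i‖)^k` (`ArchG3Functions.norm_iteratedDeriv_archF_le_of_forall`); in the archimedean Gen-3
frame `c τ 0 = t₀ + 1 ≤ T` and `c τ (k+1) = log α_k`, so that loss is `≈ k·(log T + log Σ A_k)` — NOT affordable against the gain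
`G·X·L ∝ L·log(eB)` when `log A_max ≫ log(eB)` (crux `ArchCoreRat` has no hypothesis bounding the heights by `B`).  Print (Nesterenko 2003
(4.19)–(4.23)) is Taylor-normalised: `(1/t!) f^{(t)}(x)` is a combination of the family's values with coefficients
`binom(t₀+σ₀, σ₀) · ∏_k (log α_k)^{σ_k}/σ_k!`, and `y^K/K! ≤ c^K e^{y/c}` trades the size of the logarithms for `log c` per derivative.
This file proves exactly that bookkeeping, abstractly:

* `jetA Θ t₀ s = binom(t₀+s, s)·Θ^s`, `jetB y j = y^j/j!`, **`jetMaj Θ y t₀ t = Σ_{s+j=t} jetA Θ t₀ s · jetB y j`** (the coefficient of `u^t`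
  in `(1 − Θu)^{−(t₀+1)} e^{yu}`), the EXACT recursion `(t+1)·jetMaj t₀ (t+1) = (t₀+1)Θ·jetMaj (t₀+1) t + y·jetMaj t₀ t` (`jetMaj_succ`,
  from the abstract convolution lemma `conv_succ`), and the bounds `jetMaj ≤ 2^{t₀+t}·max(1,Θ)^t·Σ_{j≤t} y^j/j! ≤ 2^{t₀+t} max(1,Θ)^t e^y`
  and, for `c ≥ 1`, `≤ 2^{t₀+t} max(1,Θ)^t c^t e^{y/c}` (`jetMaj_le_scaled` — print's `(eBN)^K e^{4nL/e}`);
* **`norm_iteratedDeriv_le_jetMaj`**: if `‖c τ 0‖ ≤ t₀ + 1`, `‖c τ (k+1)‖ ≤ ℓ_k`, and at a point `a` the values satisfy the ENVELOPE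
  `‖F τ′ a‖ ≤ ε·Θ^{t′₀}·∏_k Γ_k^{t′_k}` for `|τ′| ≤ N`, then for `|τ| + t ≤ N`:
  `‖(F τ)^{(t)}(a)‖ ≤ t! · (ε·Θ^{t₀}·∏_k Γ_k^{t_k}) · jetMaj Θ (Σ_k ℓ_k Γ_k) t₀ t`.

The instantiation for the Gen-3 class functions `ArchG3Setup.archF` (`c τ 0 = t₀+1`, `ℓ_k = |log α_k|`, `Γ_k ≥ |𝔛ₖ(vᵢ)/b_{j₀}|`) is in
`ArchG3Sizes.lean`.  WHAT THIS IS NOT: no Hermite / Cauchy step (the k-step seat's — which must likewise take `‖f^{(σ)}(xᵢ)‖ ≤ σ!·ε` as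
its input); no crux moves.

References: Yu. V. Nesterenko, LNM 1819 (2003), §4.2, Lemma 4.3, (4.19)–(4.23); M. Waldschmidt, Acta Arith. 37 (1980), Lemma 3.5.
-/

noncomputable section

open Finset
open Literature.NumberTheory.Transcendental.Baker1975 (bump bump_apply sum_bump)
open Literature.NumberTheory.Transcendental.CW77.Setup (Tau tauNorm bump0 bumpj bumpτ tauNorm_bumpτ bumpτ_zero bumpτ_succ)
open scoped Nat

namespace Summit.ABC.StewartYu.ArchJets

/-! ### The abstract convolution recursion -/

/-- **Convolution recursion.** If `(s+1)·a(s+1) = α·a′(s)` and `(j+1)·b(j+1) = y·b(j)` then the convolution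
`c(t) = Σ_{s+j=t} a(s)b(j)` satisfies `(t+1)·c(t+1) = α·Σ_{s+j=t} a′(s)b(j) + y·c(t)` (the derivative of a product of generating
functions). [folklore] -/
theorem conv_succ (a a' b : ℕ → ℝ) (α y : ℝ) (ha : ∀ s : ℕ, ((s : ℝ) + 1) * a (s + 1) = α * a' s)
    (hb : ∀ j : ℕ, ((j : ℝ) + 1) * b (j + 1) = y * b j) (t : ℕ) :
    ((t : ℝ) + 1) * ∑ p ∈ antidiagonal (t + 1), a p.1 * b p.2 =
      α * ∑ p ∈ antidiagonal t, a' p.1 * b p.2 + y * ∑ p ∈ antidiagonal t, a p.1 * b p.2 := by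
  -- `(t+1)·a(s)b(j) = s·a(s)b(j) + j·a(s)b(j)` on the antidiagonal `s + j = t + 1`
  have hsplit : ((t : ℝ) + 1) * ∑ p ∈ antidiagonal (t + 1), a p.1 * b p.2 =
      ∑ p ∈ antidiagonal (t + 1), (p.1 : ℝ) * a p.1 * b p.2 + ∑ p ∈ antidiagonal (t + 1), (p.2 : ℝ) * a p.1 * b p.2 := by
    rw [mul_sum, ← sum_add_distrib]
    refine sum_congr rfl fun p hp => ?_
    have h : p.1 + p.2 = t + 1 := mem_antidiagonal.mp hp
    have h' : (p.1 : ℝ) + p.2 = t + 1 := by exact_mod_cast h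
    rw [← h']; ring
  rw [hsplit, Nat.sum_antidiagonal_succ (f := fun p => (p.1 : ℝ) * a p.1 * b p.2),
    Nat.sum_antidiagonal_succ' (f := fun p => (p.2 : ℝ) * a p.1 * b p.2)]
  simp only [Nat.cast_zero, zero_mul, zero_add, Nat.cast_add, Nat.cast_one, mul_sum]
  congr 1
  · refine sum_congr rfl fun p _ => ?_
    have := ha p.1
    calc ((p.1 : ℝ) + 1) * a (p.1 + 1) * b p.2 = (((p.1 : ℝ) + 1) * a (p.1 + 1)) * b p.2 := by ring
      _ = α * a' p.1 * b p.2 := by rw [this]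
      _ = α * (a' p.1 * b p.2) := by ring
  · refine sum_congr rfl fun p _ => ?_
    have := hb p.2
    calc ((p.2 : ℝ) + 1) * a p.1 * b (p.2 + 1) = a p.1 * (((p.2 : ℝ) + 1) * b (p.2 + 1)) := by ring
      _ = a p.1 * (y * b p.2) := by rw [this]
      _ = y * (a p.1 * b p.2) := by ring

/-! ### The majorant -/

/-- The `Y₀`-part of the majorant: `jetA Θ t₀ s = binom(t₀+s, s)·Θ^s` (the coefficient of `u^s` in `(1 − Θu)^{−(t₀+1)}`).
[cite: Nesterenko2003, §4.2 (4.20) (the factor (μ₀+t₀)!/(μ₀! t₀!))] -/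
def jetA (Θ : ℝ) (t₀ s : ℕ) : ℝ := ((t₀ + s).choose s : ℝ) * Θ ^ s

/-- The exponential part of the majorant: `jetB y j = y^j/j!`. [cite: Nesterenko2003, §4.2 (4.20) (the factors |x_k|^{t_k}/t_k!)] -/
def jetB (y : ℝ) (j : ℕ) : ℝ := y ^ j / (j ! : ℝ)

/-- **The jets majorant** `jetMaj Θ y t₀ t = Σ_{s+j=t} binom(t₀+s,s) Θ^s · y^j/j!`. [cite: Nesterenko2003, §4.2 (4.20)–(4.22)] -/
def jetMaj (Θ y : ℝ) (t₀ t : ℕ) : ℝ := ∑ p ∈ antidiagonal t, jetA Θ t₀ p.1 * jetB y p.2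

/-- `(s+1)·jetA Θ t₀ (s+1) = (t₀+1)Θ · jetA Θ (t₀+1) s` (`(s+1)·binom(t₀+s+1, s+1) = (t₀+1)·binom(t₀+s+1, s)`). [folklore] -/
theorem jetA_succ (Θ : ℝ) (t₀ s : ℕ) : ((s : ℝ) + 1) * jetA Θ t₀ (s + 1) = ((t₀ : ℝ) + 1) * Θ * jetA Θ (t₀ + 1) s := by
  unfold jetA
  -- the binomial identity, in `ℕ`: `binom(n, t₀+1)·(t₀+1) = binom(n, t₀)·(n − t₀)` with `n = t₀ + s + 1`
  have hnat : (t₀ + (s + 1)).choose (s + 1) * (s + 1) = (t₀ + 1 + s).choose s * (t₀ + 1) := by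
    have h1 : (t₀ + (s + 1)).choose (s + 1) = (t₀ + s + 1).choose (t₀) := by
      rw [show t₀ + (s + 1) = t₀ + s + 1 by ring]
      exact Nat.choose_symm_of_eq_add (by ring)
    have h2 : (t₀ + 1 + s).choose s = (t₀ + s + 1).choose (t₀ + 1) := by
      rw [show t₀ + 1 + s = t₀ + s + 1 by ring]
      exact Nat.choose_symm_of_eq_add (by ring)
    rw [h1, h2]
    have h3 := Nat.choose_succ_right_eq (t₀ + s + 1) t₀
    -- h3 : choose (t₀+s+1) (t₀+1) * (t₀+1) = choose (t₀+s+1) t₀ * (t₀+s+1-t₀)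
    rw [show t₀ + s + 1 - t₀ = s + 1 by omega] at h3
    rw [h3]
  have hreal : (((t₀ + (s + 1)).choose (s + 1) : ℕ) : ℝ) * ((s : ℝ) + 1) = (((t₀ + 1 + s).choose s : ℕ) : ℝ) * ((t₀ : ℝ) + 1) := by
    exact_mod_cast hnat
  calc ((s : ℝ) + 1) * ((((t₀ + (s + 1)).choose (s + 1) : ℕ) : ℝ) * Θ ^ (s + 1))
      = ((((t₀ + (s + 1)).choose (s + 1) : ℕ) : ℝ) * ((s : ℝ) + 1)) * Θ ^ (s + 1) := by ring
    _ = ((((t₀ + 1 + s).choose s : ℕ) : ℝ) * ((t₀ : ℝ) + 1)) * Θ ^ (s + 1) := by rw [hreal]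
    _ = ((t₀ : ℝ) + 1) * Θ * ((((t₀ + 1 + s).choose s : ℕ) : ℝ) * Θ ^ s) := by ring

/-- `(j+1)·jetB y (j+1) = y · jetB y j`. [folklore] -/
theorem jetB_succ (y : ℝ) (j : ℕ) : ((j : ℝ) + 1) * jetB y (j + 1) = y * jetB y j := by
  unfold jetB
  rw [Nat.factorial_succ, Nat.cast_mul, pow_succ]
  have hj : ((j ! : ℕ) : ℝ) ≠ 0 := by positivity
  have hj1 : ((j + 1 : ℕ) : ℝ) ≠ 0 := by positivity
  field_simp
  push_cast
  ring

/-- `jetMaj Θ y t₀ 0 = 1`. [folklore] -/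
@[simp] theorem jetMaj_zero (Θ y : ℝ) (t₀ : ℕ) : jetMaj Θ y t₀ 0 = 1 := by
  simp [jetMaj, jetA, jetB]

/-- **The exact recursion** `(t+1)·jetMaj Θ y t₀ (t+1) = (t₀+1)Θ·jetMaj Θ y (t₀+1) t + y·jetMaj Θ y t₀ t` — the image of
`d/du [(1 − Θu)^{−(t₀+1)} e^{yu}] = (t₀+1)Θ (1 − Θu)^{−(t₀+2)} e^{yu} + y (1 − Θu)^{−(t₀+1)} e^{yu}`. [folklore] -/
theorem jetMaj_succ (Θ y : ℝ) (t₀ t : ℕ) :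
    ((t : ℝ) + 1) * jetMaj Θ y t₀ (t + 1) = ((t₀ : ℝ) + 1) * Θ * jetMaj Θ y (t₀ + 1) t + y * jetMaj Θ y t₀ t :=
  conv_succ (jetA Θ t₀) (jetA Θ (t₀ + 1)) (jetB y) (((t₀ : ℝ) + 1) * Θ) y (jetA_succ Θ t₀) (jetB_succ y) t

/-- `0 ≤ jetA` for `Θ ≥ 0`. [folklore] -/
theorem jetA_nonneg {Θ : ℝ} (hΘ : 0 ≤ Θ) (t₀ s : ℕ) : 0 ≤ jetA Θ t₀ s := by
  unfold jetA; positivity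

/-- `0 ≤ jetB` for `y ≥ 0`. [folklore] -/
theorem jetB_nonneg {y : ℝ} (hy : 0 ≤ y) (j : ℕ) : 0 ≤ jetB y j := by
  unfold jetB; positivity

/-- `0 ≤ jetMaj` for `Θ, y ≥ 0`. [folklore] -/
theorem jetMaj_nonneg {Θ y : ℝ} (hΘ : 0 ≤ Θ) (hy : 0 ≤ y) (t₀ t : ℕ) : 0 ≤ jetMaj Θ y t₀ t :=
  sum_nonneg fun _ _ => mul_nonneg (jetA_nonneg hΘ _ _) (jetB_nonneg hy _)

/-- `jetA Θ t₀ s ≤ 2^{t₀+s}·Θ^s` (`binom(t₀+s, s) ≤ 2^{t₀+s}`). [folklore] -/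
theorem jetA_le {Θ : ℝ} (hΘ : 0 ≤ Θ) (t₀ s : ℕ) : jetA Θ t₀ s ≤ 2 ^ (t₀ + s) * Θ ^ s := by
  unfold jetA
  refine mul_le_mul_of_nonneg_right ?_ (pow_nonneg hΘ _)
  exact_mod_cast Nat.choose_le_two_pow (t₀ + s) s

/-- **`jetMaj Θ y t₀ t ≤ 2^{t₀+t}·max(1,Θ)^t·Σ_{j≤t} y^j/j!`** for `Θ, y ≥ 0`. [folklore] -/
theorem jetMaj_le_sum {Θ y : ℝ} (hΘ : 0 ≤ Θ) (hy : 0 ≤ y) (t₀ t : ℕ) :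
    jetMaj Θ y t₀ t ≤ 2 ^ (t₀ + t) * (max 1 Θ) ^ t * ∑ j ∈ range (t + 1), y ^ j / (j ! : ℝ) := by
  have hM1 : 1 ≤ max 1 Θ := le_max_left _ _
  have hΘM : Θ ≤ max 1 Θ := le_max_right _ _
  unfold jetMaj
  calc ∑ p ∈ antidiagonal t, jetA Θ t₀ p.1 * jetB y p.2
      ≤ ∑ p ∈ antidiagonal t, (2 ^ (t₀ + t) * (max 1 Θ) ^ t) * jetB y p.2 := by
        refine sum_le_sum fun p hp => mul_le_mul_of_nonneg_right ?_ (jetB_nonneg hy _)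
        have hpt : p.1 ≤ t := by have := mem_antidiagonal.mp hp; omega
        calc jetA Θ t₀ p.1 ≤ 2 ^ (t₀ + p.1) * Θ ^ p.1 := jetA_le hΘ t₀ p.1
          _ ≤ 2 ^ (t₀ + t) * (max 1 Θ) ^ p.1 :=
              mul_le_mul (pow_le_pow_right₀ (by norm_num) (by omega)) (pow_le_pow_left₀ hΘ hΘM _)
                (pow_nonneg hΘ _) (by positivity)
          _ ≤ 2 ^ (t₀ + t) * (max 1 Θ) ^ t :=
              mul_le_mul_of_nonneg_left (pow_le_pow_right₀ hM1 hpt) (by positivity)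
    _ = 2 ^ (t₀ + t) * (max 1 Θ) ^ t * ∑ p ∈ antidiagonal t, jetB y p.2 := by rw [mul_sum]
    _ = 2 ^ (t₀ + t) * (max 1 Θ) ^ t * ∑ j ∈ range (t + 1), y ^ j / (j ! : ℝ) := by
        congr 1
        rw [Nat.sum_antidiagonal_eq_sum_range_succ_mk, ← sum_range_reflect]
        refine sum_congr rfl fun j hj => ?_
        have hjt : j < t + 1 := mem_range.mp hj
        simp only [jetB]
        rw [show t + 1 - 1 - j = t - j by omega, show t - (t - j) = j by omega]

/-- **`jetMaj Θ y t₀ t ≤ 2^{t₀+t}·max(1,Θ)^t·e^y`** for `Θ, y ≥ 0`. [folklore] -/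
theorem jetMaj_le_exp {Θ y : ℝ} (hΘ : 0 ≤ Θ) (hy : 0 ≤ y) (t₀ t : ℕ) :
    jetMaj Θ y t₀ t ≤ 2 ^ (t₀ + t) * (max 1 Θ) ^ t * Real.exp y :=
  (jetMaj_le_sum hΘ hy t₀ t).trans (mul_le_mul_of_nonneg_left (Real.sum_le_exp_of_nonneg hy _) (by positivity))

/-- **The scaled bound** `jetMaj Θ y t₀ t ≤ 2^{t₀+t}·max(1,Θ)^t·c^t·e^{y/c}` for `c ≥ 1` (`y^j/j! = c^j (y/c)^j/j! ≤ c^t e^{y/c}`): the size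
`y` of the logarithms is traded for `log c` per derivative — print's `(4nNBL+μ)^K/K! ≤ (eBN)^K e^{4nL/e}`.
[cite: Nesterenko2003, §4.2 (4.22)–(4.23)] -/
theorem jetMaj_le_scaled {Θ y c : ℝ} (hΘ : 0 ≤ Θ) (hy : 0 ≤ y) (hc : 1 ≤ c) (t₀ t : ℕ) :
    jetMaj Θ y t₀ t ≤ 2 ^ (t₀ + t) * (max 1 Θ) ^ t * c ^ t * Real.exp (y / c) := by
  have hc0 : 0 < c := lt_of_lt_of_le one_pos hc
  have hyc : 0 ≤ y / c := div_nonneg hy hc0.le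
  have hsum : ∑ j ∈ range (t + 1), y ^ j / (j ! : ℝ) ≤ c ^ t * Real.exp (y / c) := by
    calc ∑ j ∈ range (t + 1), y ^ j / (j ! : ℝ) ≤ ∑ j ∈ range (t + 1), c ^ t * ((y / c) ^ j / (j ! : ℝ)) := by
          refine sum_le_sum fun j hj => ?_
          have hjt : j ≤ t := by have := mem_range.mp hj; omega
          have hy' : y ^ j = c ^ j * (y / c) ^ j := by
            rw [← mul_pow, mul_div_cancel₀ _ hc0.ne']
          rw [hy', mul_div_assoc]
          exact mul_le_mul_of_nonneg_right (pow_le_pow_right₀ hc hjt) (by positivity)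
      _ = c ^ t * ∑ j ∈ range (t + 1), (y / c) ^ j / (j ! : ℝ) := by rw [mul_sum]
      _ ≤ c ^ t * Real.exp (y / c) := mul_le_mul_of_nonneg_left (Real.sum_le_exp_of_nonneg hyc _) (by positivity)
  calc jetMaj Θ y t₀ t ≤ 2 ^ (t₀ + t) * (max 1 Θ) ^ t * ∑ j ∈ range (t + 1), y ^ j / (j ! : ℝ) := jetMaj_le_sum hΘ hy t₀ t
    _ ≤ 2 ^ (t₀ + t) * (max 1 Θ) ^ t * (c ^ t * Real.exp (y / c)) := mul_le_mul_of_nonneg_left hsum (by positivity)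
    _ = _ := by ring

/-! ### Derivatives of a `d/dz`-closed family from an envelope on its values -/

/-- `∏_j Γ_j^{(t + e_k)_j} = (∏_j Γ_j^{t_j}) · Γ_k`. [folklore] -/
theorem prod_pow_bump {n : ℕ} (Γ : Fin n → ℝ) (t : Fin n → ℕ) (k : Fin n) :
    ∏ j, Γ j ^ bump t k j = (∏ j, Γ j ^ t j) * Γ k := by
  simp_rw [bump_apply, pow_add, prod_mul_distrib]
  congr 1
  rw [Fintype.prod_eq_single k (fun k' hk' => by rw [if_neg hk', pow_zero]), if_pos rfl, pow_one]

/-- The envelope weight of a multi-order: `env Θ Γ τ = Θ^{t₀} · ∏_k Γ_k^{t_k}`. [folklore] -/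
def env {n : ℕ} (Θ : ℝ) (Γ : Fin n → ℝ) (τ : Tau n) : ℝ := Θ ^ τ.1 * ∏ k, Γ k ^ τ.2 k

/-- `env (τ + e₀) = Θ · env τ`. [folklore] -/
theorem env_bump0 {n : ℕ} (Θ : ℝ) (Γ : Fin n → ℝ) (τ : Tau n) : env Θ Γ (bump0 τ) = Θ * env Θ Γ τ := by
  simp only [env, bump0, pow_succ]; ring

/-- `env (τ + e_{k+1}) = Γ_k · env τ`. [folklore] -/
theorem env_bumpj {n : ℕ} (Θ : ℝ) (Γ : Fin n → ℝ) (τ : Tau n) (k : Fin n) : env Θ Γ (bumpj τ k) = Γ k * env Θ Γ τ := by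
  simp only [env, bumpj]; rw [prod_pow_bump]; ring

/-- `0 ≤ env` for non-negative data. [folklore] -/
theorem env_nonneg {n : ℕ} {Θ : ℝ} {Γ : Fin n → ℝ} (hΘ : 0 ≤ Θ) (hΓ : ∀ k, 0 ≤ Γ k) (τ : Tau n) : 0 ≤ env Θ Γ τ :=
  mul_nonneg (pow_nonneg hΘ _) (prod_nonneg fun k _ => pow_nonneg (hΓ k) _)

/-- **The Taylor-normalised control of derivatives by values.**  Let `F : Tau n → ℂ → ℂ` be a family of entire functions with
`deriv (F τ) z = Σ_{i : Fin (n+1)} c τ i · F (τ + eᵢ) z` (pointwise, the `hode` shape of `ArchKStep.iteratedDeriv_succ_of_ode`), `‖c τ 0‖ ≤ t₀ + 1` and `‖c τ (k+1)‖ ≤ ℓ_k`.  If at a point `a` the values satisfy the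
envelope `‖F τ′ a‖ ≤ ε · Θ^{t′₀} ∏_k Γ_k^{t′_k}` whenever `|τ′| ≤ N` (`Θ, Γ_k, ℓ_k ≥ 0`), then for `|τ| + t ≤ N`:
`‖(F τ)^{(t)}(a)‖ ≤ t! · ε · Θ^{t₀} ∏_k Γ_k^{t_k} · jetMaj Θ (Σ_k ℓ_k Γ_k) t₀ t`.
[cite: Nesterenko2003, §4.2 (4.20)–(4.22)] [cite: Waldschmidt1980, Lemma 3.5 (p. 270)] -/
theorem norm_iteratedDeriv_le_jetMaj {n : ℕ} (F : Tau n → ℂ → ℂ) (c : Tau n → Fin (n + 1) → ℂ)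
    (hF : ∀ τ, Differentiable ℂ (F τ)) (hderiv : ∀ τ z, deriv (F τ) z = ∑ i, c τ i * F (bumpτ τ i) z)
    {Θ : ℝ} {ℓ Γ : Fin n → ℝ} (hΘ : 0 ≤ Θ) (hℓ : ∀ k, 0 ≤ ℓ k) (hΓ : ∀ k, 0 ≤ Γ k)
    (hc0 : ∀ τ, ‖c τ 0‖ ≤ (τ.1 : ℝ) + 1) (hck : ∀ τ k, ‖c τ k.succ‖ ≤ ℓ k)
    (a : ℂ) (N : ℕ) {ε : ℝ} (hval : ∀ τ, tauNorm τ ≤ N → ‖F τ a‖ ≤ ε * env Θ Γ τ) :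
    ∀ (t : ℕ) (τ : Tau n), tauNorm τ + t ≤ N →
      ‖iteratedDeriv t (F τ) a‖ ≤ (t ! : ℝ) * (ε * env Θ Γ τ) * jetMaj Θ (∑ k, ℓ k * Γ k) τ.1 t := by
  set y : ℝ := ∑ k, ℓ k * Γ k with hy
  have hy0 : 0 ≤ y := sum_nonneg fun k _ => mul_nonneg (hℓ k) (hΓ k)
  have hcd : ∀ τ {m : WithTop ℕ∞}, ContDiff ℂ m (F τ) := fun τ => (hF τ).contDiff.of_le le_top
  intro t
  induction t with
  | zero =>
    intro τ hτ
    simpa using hval τ (by simpa using hτ)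
  | succ t ih =>
    intro τ hτ
    have hτN : tauNorm τ ≤ N := by omega
    -- the recursion of the iterated derivative
    have hrec : iteratedDeriv (t + 1) (F τ) a = ∑ i, c τ i * iteratedDeriv t (F (bumpτ τ i)) a := by
      rw [iteratedDeriv_succ', show deriv (F τ) = fun z => ∑ i, c τ i * F (bumpτ τ i) z from funext (hderiv τ)]
      rw [iteratedDeriv_fun_sum fun i _ => (contDiff_const.mul (hcd (bumpτ τ i))).contDiffAt]
      exact sum_congr rfl fun i _ => iteratedDeriv_const_mul _ (hcd (bumpτ τ i)).contDiffAt
    -- the inductive bounds in the two kinds of directions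
    have hE0 := env_nonneg hΘ hΓ τ
    have h0 : ‖c τ 0 * iteratedDeriv t (F (bumpτ τ 0)) a‖ ≤
        ((τ.1 : ℝ) + 1) * ((t ! : ℝ) * (ε * (Θ * env Θ Γ τ)) * jetMaj Θ y (τ.1 + 1) t) := by
      rw [norm_mul]
      have hi := ih (bumpτ τ 0) (by rw [tauNorm_bumpτ]; omega)
      rw [bumpτ_zero, env_bump0] at hi
      rw [bumpτ_zero]
      exact mul_le_mul (hc0 τ) hi (norm_nonneg _) (by positivity)
    have hk : ∀ k : Fin n, ‖c τ k.succ * iteratedDeriv t (F (bumpτ τ k.succ)) a‖ ≤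
        ℓ k * ((t ! : ℝ) * (ε * (Γ k * env Θ Γ τ)) * jetMaj Θ y τ.1 t) := by
      intro k
      rw [norm_mul]
      have hi := ih (bumpτ τ k.succ) (by rw [tauNorm_bumpτ]; omega)
      rw [bumpτ_succ, env_bumpj] at hi
      rw [bumpτ_succ]
      exact mul_le_mul (hck τ k) hi (norm_nonneg _) (hℓ k)
    have hJ0 : 0 ≤ jetMaj Θ y τ.1 t := jetMaj_nonneg hΘ hy0 _ _
    have hJ1 : 0 ≤ jetMaj Θ y (τ.1 + 1) t := jetMaj_nonneg hΘ hy0 _ _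
    rw [hrec, Fin.sum_univ_succ]
    calc ‖c τ 0 * iteratedDeriv t (F (bumpτ τ 0)) a + ∑ k : Fin n, c τ k.succ * iteratedDeriv t (F (bumpτ τ k.succ)) a‖
        ≤ ‖c τ 0 * iteratedDeriv t (F (bumpτ τ 0)) a‖ + ∑ k : Fin n, ‖c τ k.succ * iteratedDeriv t (F (bumpτ τ k.succ)) a‖ :=
          (norm_add_le _ _).trans (add_le_add le_rfl (norm_sum_le _ _))
      _ ≤ ((τ.1 : ℝ) + 1) * ((t ! : ℝ) * (ε * (Θ * env Θ Γ τ)) * jetMaj Θ y (τ.1 + 1) t) +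
            ∑ k : Fin n, ℓ k * ((t ! : ℝ) * (ε * (Γ k * env Θ Γ τ)) * jetMaj Θ y τ.1 t) :=
          add_le_add h0 (sum_le_sum fun k _ => hk k)
      _ = (t ! : ℝ) * (ε * env Θ Γ τ) * ((((τ.1 : ℝ) + 1) * Θ * jetMaj Θ y (τ.1 + 1) t) + y * jetMaj Θ y τ.1 t) := by
          rw [hy, sum_mul, mul_add, mul_sum]
          congr 1
          · ring
          · exact sum_congr rfl fun k _ => by ring
      _ = (t ! : ℝ) * (ε * env Θ Γ τ) * (((t : ℝ) + 1) * jetMaj Θ y τ.1 (t + 1)) := by rw [jetMaj_succ]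
      _ = ((t + 1) ! : ℝ) * (ε * env Θ Γ τ) * jetMaj Θ y τ.1 (t + 1) := by
          rw [Nat.factorial_succ, Nat.cast_mul]; push_cast; ring

/-- **Corollary (Taylor coefficients, scaled form).**  Under the hypotheses of `norm_iteratedDeriv_le_jetMaj`, for every `c ≥ 1`:
`‖(F τ)^{(t)}(a)‖ / t! ≤ ε · Θ^{t₀}∏Γ^{t} · 2^{t₀+t} · max(1,Θ)^t · c^t · exp((Σ_k ℓ_kΓ_k)/c)` — `log 2 + log max(1,Θ) + log c` per
derivative plus the one-off `Σ ℓ_kΓ_k / c`. [cite: Nesterenko2003, §4.2 (4.22)–(4.23)] -/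
theorem norm_iteratedDeriv_div_factorial_le {n : ℕ} (F : Tau n → ℂ → ℂ) (c : Tau n → Fin (n + 1) → ℂ)
    (hF : ∀ τ, Differentiable ℂ (F τ)) (hderiv : ∀ τ z, deriv (F τ) z = ∑ i, c τ i * F (bumpτ τ i) z)
    {Θ : ℝ} {ℓ Γ : Fin n → ℝ} (hΘ : 0 ≤ Θ) (hℓ : ∀ k, 0 ≤ ℓ k) (hΓ : ∀ k, 0 ≤ Γ k)
    (hc0 : ∀ τ, ‖c τ 0‖ ≤ (τ.1 : ℝ) + 1) (hck : ∀ τ k, ‖c τ k.succ‖ ≤ ℓ k)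
    (a : ℂ) (N : ℕ) {ε : ℝ} (hε : 0 ≤ ε) (hval : ∀ τ, tauNorm τ ≤ N → ‖F τ a‖ ≤ ε * env Θ Γ τ)
    {C : ℝ} (hC : 1 ≤ C) {t : ℕ} {τ : Tau n} (hτ : tauNorm τ + t ≤ N) :
    ‖iteratedDeriv t (F τ) a‖ / (t ! : ℝ) ≤
      ε * env Θ Γ τ * (2 ^ (τ.1 + t) * (max 1 Θ) ^ t * C ^ t * Real.exp ((∑ k, ℓ k * Γ k) / C)) := by
  have hfac : (0 : ℝ) < (t ! : ℝ) := by positivity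
  rw [div_le_iff₀ hfac]
  have h := norm_iteratedDeriv_le_jetMaj F c hF hderiv hΘ hℓ hΓ hc0 hck a N hval t τ hτ
  refine h.trans ?_
  have hy0 : 0 ≤ ∑ k, ℓ k * Γ k := sum_nonneg fun k _ => mul_nonneg (hℓ k) (hΓ k)
  have hJ := jetMaj_le_scaled hΘ hy0 hC τ.1 t
  have hE0 : 0 ≤ ε * env Θ Γ τ := mul_nonneg hε (env_nonneg hΘ hΓ τ)
  calc (t ! : ℝ) * (ε * env Θ Γ τ) * jetMaj Θ (∑ k, ℓ k * Γ k) τ.1 t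
      ≤ (t ! : ℝ) * (ε * env Θ Γ τ) * (2 ^ (τ.1 + t) * (max 1 Θ) ^ t * C ^ t * Real.exp ((∑ k, ℓ k * Γ k) / C)) :=
        mul_le_mul_of_nonneg_left hJ (by positivity)
    _ = _ := by ring

end Summit.ABC.StewartYu.ArchJets

end
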